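import Summits.ResolutionOfSingularities.ResolutionOfSingularities.Theorems.FrobeniusLadderFRationalResolutionDescentDatumCentre
import Summits.ResolutionOfSingularities.ResolutionOfSingularities.Theorems.FrobeniusLadderFRationalResolutionDescentDatumLocal
import HarnessLib

/-!
# Crux `FrobeniusLadder.FRationalResolution` (stmt-ResolutionOfSingularities-15317), line `redirect`,
# stub `stub_diagonalizableQuotientResolution` — E-k (trivial residue extension) RE-DERIVED from the descent-datum
# brick: consistency of `…DescentDatumCentre` with `…PrimaryCentreEtale`

`…DescentDatumLocal.map_includeLeft_le_of_residue_surjective` (trivial residue extension at the unique prime `𝔔` over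
`𝔭` of a formally unramified chart essentially of finite type ⇒ descent datum for every `J ⊇ 𝔔ⁿ`) feeds
`…DescentDatumCentre.hloc_of_flat_chart_of_descent`; the result is brick E-k again, with the unramifiedness packaged
as `Algebra.FormallyUnramified B C` + "`𝔔` is the only prime over `𝔭`" instead of `𝔭 C_𝔔 = 𝔪_{C_𝔔}` + the basic
open `D(g)` of `…FibreReduced`:

* `hloc_of_flat_chart_of_residue_surjective` — the local resolution datum at `ι 𝔭`;
* `hasResolution_of_flat_charts_of_residue_surjective` — the assembly over the finitely many singular points.

Honest label: consistency corollary (no stub closed by name). No definitions, no named facts, no sorry.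
[cite: StacksProject, Tag 0245; Tag 00UW] [folklore; cite: Kollar2007, §2.2]
-/

noncomputable section

-- single-problem summit: the doubled namespace component is forced
set_option linter.dupNamespace false

open CategoryTheory AlgebraicGeometry TopologicalSpace TensorProduct
open Literature.AlgebraicGeometry.Resolution

namespace Summit.ResolutionOfSingularities.ResolutionOfSingularities.Theorems.FRationalResolution.DescentDatumCentre

/-- **E-k from descent.** Data: `ι : Spec B → X` affine open over `k` (`B` a domain of finite type over `k`), `𝔭 ⊆ B`
maximal `≠ 0` with `ι 𝔭` singular and all other points of `Spec B` regular; `C` a flat, finitely presented, formally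
unramified `B`-algebra; `𝔔 ⊆ C` maximal, the only prime over `𝔭`, with every `c ∈ C` congruent mod `𝔔` to an
element of `B`; `J ⊆ C` with `𝔔ⁿ ⊆ J ⊆ 𝔔` and `Bl_J(Spec C)` regular. Then `ι 𝔭` has the local resolution datum.
[cite: StacksProject, Tag 0245; Tag 00UW] [cite: Kollar2007, §2.2] -/
theorem hloc_of_flat_chart_of_residue_surjective (k : Type) [Field k] (X : Scheme.{0}) [IsIntegral X]
    (f : X ⟶ Spec (.of k)) [LocallyOfFiniteType f]
    {B C : Type} [CommRing B] [CommRing C] [Algebra B C] [IsDomain B] [Algebra k B] [Algebra.FiniteType k B]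
    [Module.Flat B C] [Algebra.FinitePresentation B C] [Algebra.FormallyUnramified B C]
    (ι : Spec (.of B) ⟶ X) [IsOpenImmersion ι] (hι : ι ≫ f = Spec.map (CommRingCat.ofHom (algebraMap k B)))
    (𝔭 : Ideal B) [h𝔭 : 𝔭.IsMaximal] (h𝔭0 : 𝔭 ≠ ⊥)
    (hsing : ι ⟨𝔭, h𝔭.isPrime⟩ ∉ Scheme.regularLocus X)
    (hregB : ∀ P : Spec (.of B), P.asIdeal ≠ 𝔭 → P ∈ Scheme.regularLocus (Spec (.of B)))
    (𝔔 : Ideal C) [h𝔔 : 𝔔.IsMaximal] (h𝔔𝔭 : 𝔔.comap (algebraMap B C) = 𝔭)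
    (huniq : ∀ 𝔔' : Ideal C, 𝔔'.IsPrime → 𝔔'.comap (algebraMap B C) = 𝔭 → 𝔔' = 𝔔)
    (hres : ∀ c : C, ∃ b : B, c - algebraMap B C b ∈ 𝔔)
    (J : Ideal C) {n : ℕ} (hJ : 𝔔 ^ n ≤ J) (hJ𝔔 : J ≤ 𝔔) (hregJ : Scheme.IsRegular (affineBlowup J)) :
    ∃ (V : X.Opens), ι ⟨𝔭, h𝔭.isPrime⟩ ∈ V ∧
      (∀ t : X, t ∉ Scheme.regularLocus X → t ∈ V → t = ι ⟨𝔭, h𝔭.isPrime⟩) ∧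
      ∃ (Y : Scheme.{0}) (ρ : Y ⟶ V), IsProper ρ ∧ Scheme.IsRegular Y ∧
        IsIso (ρ ∣_ (V.ι ⁻¹ᵁ ⟨Scheme.regularLocus X, isOpen_regularLocus_of_locallyOfFiniteType_field f⟩)) ∧
        Dense ((ρ ⁻¹ᵁ (V.ι ⁻¹ᵁ ⟨Scheme.regularLocus X,
          isOpen_regularLocus_of_locallyOfFiniteType_field f⟩) : Y.Opens) : Set Y) := by
  haveI : Algebra.FiniteType B C := inferInstance
  haveI : Algebra.EssFiniteType B C := Algebra.EssFiniteType.of_finiteType B C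
  have hdesc := DescentDatumLocal.map_includeLeft_le_of_residue_surjective 𝔔
    (fun 𝔔' h𝔔' h => huniq 𝔔' h𝔔' (h.trans h𝔔𝔭)) hres J hJ
  exact hloc_of_flat_chart_of_descent k X f ι hι 𝔭 h𝔭0 hsing hregB 𝔔 h𝔔𝔭 J hJ hJ𝔔 hdesc hregJ

/-- **E-k from descent, assembled**: an integral `X` locally of finite type over any field whose finitely many
singular points all carry flat, finitely presented, formally unramified charts with a unique prime `𝔔` over the
point, trivial residue extension there, and a regular blow-up of a `𝔔`-primary centre, has a resolution of
singularities. [cite: StacksProject, Tag 0245; Tag 00UW] [cite: Kollar2007, §2.2] -/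
theorem hasResolution_of_flat_charts_of_residue_surjective (k : Type) [Field k] (X : Scheme.{0}) [IsIntegral X]
    (f : X ⟶ Spec (.of k)) [LocallyOfFiniteType f] (hfin : (Scheme.regularLocus X)ᶜ.Finite)
    (hchart : ∀ s : X, s ∉ Scheme.regularLocus X →
      ∃ (B C : Type) (_ : CommRing B) (_ : CommRing C) (_ : Algebra B C) (_ : IsDomain B) (_ : Algebra k B)
        (_ : Algebra.FiniteType k B) (_ : Module.Flat B C) (_ : Algebra.FinitePresentation B C)
        (_ : Algebra.FormallyUnramified B C)
        (ι : Spec (.of B) ⟶ X) (_ : IsOpenImmersion ι)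
        (_ : ι ≫ f = Spec.map (CommRingCat.ofHom (algebraMap k B)))
        (𝔭 : Ideal B) (h𝔭 : 𝔭.IsMaximal) (_ : 𝔭 ≠ ⊥) (_ : ι ⟨𝔭, h𝔭.isPrime⟩ = s)
        (_ : ∀ P : Spec (.of B), P.asIdeal ≠ 𝔭 → P ∈ Scheme.regularLocus (Spec (.of B)))
        (𝔔 : Ideal C) (_ : 𝔔.IsMaximal) (J : Ideal C) (n : ℕ), 𝔔.comap (algebraMap B C) = 𝔭 ∧
          (∀ 𝔔' : Ideal C, 𝔔'.IsPrime → 𝔔'.comap (algebraMap B C) = 𝔭 → 𝔔' = 𝔔) ∧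
          (∀ c : C, ∃ b : B, c - algebraMap B C b ∈ 𝔔) ∧
          𝔔 ^ n ≤ J ∧ J ≤ 𝔔 ∧ Scheme.IsRegular (affineBlowup J)) :
    Scheme.HasResolution X := by
  refine IsolatedGlue.hasResolution_of_finite_singularLocus_of_local k X f hfin fun s hs => ?_
  obtain ⟨B, C, _, _, _, _, _, _, _, _, _, ι, _, hι, 𝔭, h𝔭, h𝔭0, hιs, hregB, 𝔔, _, J, n, h𝔔, huniq, hres, hJ,
    hJ𝔔, hregJ⟩ := hchart s hs
  subst hιs
  exact hloc_of_flat_chart_of_residue_surjective k X f ι hι 𝔭 h𝔭0 hs hregB 𝔔 h𝔔 huniq hres J hJ hJ𝔔 hregJ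

end Summit.ResolutionOfSingularities.ResolutionOfSingularities.Theorems.FRationalResolution.DescentDatumCentre

end
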